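import Summits.QuantumAdvantage.QuantumAdvantage.Theses.SpreadCore
import Summits.QuantumAdvantage.QuantumAdvantage.Theorems.SpreadCoreBridge

/-!
# SpreadCore — `SpreadBridgeOdd` (stmt-QuantumAdvantage-30737) holds

lens-6 g6 «SpreadCore» (critic rows 38/38v2; Theorems twin `SpreadCoreBridge` landed in three modules): the WEIGHTED hybrid
lemma followed by the WEIGHTED packing gives `SpreadDistOdd → GridCoreDistOdd` — the bridge binder `hB`-side support of
route-QuantumAdvantage-SpreadCore (`Theorems.SpreadCore.gridCoreDistOdd_of_spreadDistOdd`); the route item inlines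
`SpreadDistOdd`, so the junction is definitional.  Also by name: the dominance edge `distLiftOdd_of_coverLiftDistOdd`
(CoverLiftDistOdd 30736 ⟹ HardCore's DistLiftOdd 28223).

Cell decomp-qadv (D-0178/D-0179), census seat decomp-qadv-census-1 g6 (prover lane); mathematics: lens-6 g5/g6.
-/

set_option linter.dupNamespace false -- D-0017: single-problem summit ⇒ `QuantumAdvantage.QuantumAdvantage` by design

namespace Summit.QuantumAdvantage.QuantumAdvantage.Theorems

/-- **`SpreadCore.SpreadBridgeOdd` holds** (support stmt-QuantumAdvantage-30737): spread-form distributional hardness of the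
odd-prime walk core implies the grid-core distributional statement, by weighted hybrid + weighted packing. -/
theorem spreadCore_spreadBridgeOdd : Summit.QuantumAdvantage.QuantumAdvantage.Theses.SpreadCore.SpreadBridgeOdd :=
  fun h => SpreadCore.gridCoreDistOdd_of_spreadDistOdd h

end Summit.QuantumAdvantage.QuantumAdvantage.Theorems
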